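import Mathlib
import Literature.Analysis.Complex.PelletTheorem
import HarnessLib

/-!
# ValiantsHypothesis / LacunarySymmetroid — crux `MatrixDescartes` (stmt-ValiantsHypothesis-18050, V1), LINE (A) «product_plus_one»:
# the TIE LAW, kernel path Stage 2, part 1 — persistence of polynomial root counts (disc-Rouché toolkit)

Generic facts about the roots of a family of complex polynomials `P i ∈ ℂ[X]` of bounded degree whose coefficients
depend continuously on a parameter `i`, all derived from Rouché's theorem for polynomials on circles
(`Literature.Analysis.Complex.Pellet.card_roots_eq_of_norm_sub_lt`) and degree bookkeeping — no winding numbers on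
general curves, no implicit-function theorem:

* `card_roots_ball_eventually_eq` — if `P i₀` has no root on the circle `‖z − z₀‖ = ρ`, then for `i` near `i₀` the number
  of roots of `P i` in the open disc (with multiplicity) equals that of `P i₀` (continuity of roots, disc form);
* `card_roots_filter_eventually_eq` — the bookkeeping lemma: if the top coefficient of `P i₀` is non-zero and every root
  `z` of `P i₀` carries a small disc on which, eventually along a filter `l ≤ 𝓝 i₀`, membership of the roots of `P i` in a
  set `V` is decided by a predicate `τ z`, then eventually `#{roots of P i in V} = #{roots z of P i₀ with τ z}`;
* `card_roots_filter_eq_of_preconnected'` / `card_roots_filter_eq_of_preconnected` — hence the number of roots in a set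
  `V` is constant along a preconnected parameter set on which every root carries such side information, in particular
  when all roots stay in `U ∪ E`, `U`, `E` open and disjoint (no root on the common boundary);
* (the first-order EXIT LEMMA for a simple boundary root and the persistence of real simple roots are in the sequel file
  `…TieLawRootExit`).

These are the analytic inputs of the §45 proof of the tie law (pen val-idea-25 g8; HOME NOTE §45.2–45.4), used in the
sequel files.  HONEST FRAMING: helper lemmas only; no stub of LINE (A) is touched; `MatrixDescartes` OPEN; `VP ≠ VNP` is NOT
proved.  No definitions, no named facts.
-/

set_option linter.dupNamespace false

namespace Summit.ValiantsHypothesis.ValiantsHypothesis.Theorems.LacunarySymmetroidMatrixDescartes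

namespace TieLaw

open Polynomial Filter Topology
open Literature.Analysis.Complex.Pellet



/-- Coefficient bound for the values of a polynomial of degree `≤ n` on the disc `‖z‖ ≤ R`. -/
theorem norm_eval_le_sum {p : ℂ[X]} {n : ℕ} (hp : p.natDegree ≤ n) {z : ℂ} {R : ℝ} (hz : ‖z‖ ≤ R) :
    ‖p.eval z‖ ≤ ∑ k ∈ Finset.range (n + 1), ‖p.coeff k‖ * R ^ k := by
  rw [eval_eq_sum_range' (Nat.lt_succ_of_le hp)]
  refine (norm_sum_le _ _).trans (Finset.sum_le_sum fun k _ => ?_)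
  rw [norm_mul, norm_pow]
  exact mul_le_mul_of_nonneg_left (pow_le_pow_left₀ (norm_nonneg _) hz k) (norm_nonneg _)

/-- A finite family of positive reals has a positive lower bound. -/
theorem exists_pos_forall_le {α : Type*} (s : Finset α) (f : α → ℝ) (h : ∀ a ∈ s, 0 < f a) :
    ∃ ρ : ℝ, 0 < ρ ∧ ∀ a ∈ s, ρ ≤ f a := by
  rcases s.eq_empty_or_nonempty with hs | hs
  · exact ⟨1, one_pos, by simp [hs]⟩
  · obtain ⟨a, ha, hmin⟩ := s.exists_min_image f hs
    exact ⟨f a, h a ha, hmin⟩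

/-- Filtering a multiset by a finite disjunction of pairwise incompatible predicates splits it as a sum. -/
theorem filter_exists_eq_sum {α β : Type*} (s : Multiset β) (S : Finset α) (p : α → β → Prop)
    [∀ a, DecidablePred (p a)] [DecidablePred fun x => ∃ a ∈ S, p a x]
    (hdisj : ∀ a ∈ S, ∀ a' ∈ S, a ≠ a' → ∀ x ∈ s, p a x → ¬ p a' x) :
    s.filter (fun x => ∃ a ∈ S, p a x) = ∑ a ∈ S, s.filter (p a) := by
  classical
  suffices key : ∀ T : Finset α, T ⊆ S →
      s.filter (fun x => ∃ a ∈ T, p a x) = ∑ a ∈ T, s.filter (p a) by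
    convert key S subset_rfl
  intro T hT
  induction T using Finset.induction_on with
  | empty => simp
  | @insert a T haT ih =>
    have hTS : T ⊆ S := fun b hb => hT (Finset.mem_insert_of_mem hb)
    have haS : a ∈ S := hT (Finset.mem_insert_self a T)
    rw [Finset.sum_insert haT, ← ih hTS]
    have h0 : s.filter (fun x => p a x ∧ ∃ b ∈ T, p b x) = 0 := by
      refine Multiset.filter_eq_nil.2 fun x hx hpx => ?_
      obtain ⟨b, hb, hbx⟩ := hpx.2
      have hab : a ≠ b := fun h => haT (h ▸ hb)
      exact hdisj a haS b (hTS hb) hab x hx hpx.1 hbx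
    have hsplit := Multiset.filter_add_filter (p a) (fun x => ∃ b ∈ T, p b x) s
    rw [h0, add_zero] at hsplit
    rw [hsplit]
    refine Multiset.filter_congr fun x _ => ?_
    simp [Finset.mem_insert, or_and_right, exists_or]

/-- **Continuity of roots, disc form.** Let `P i ∈ ℂ[X]` have degree `≤ n` with coefficients continuous at `i₀`, and
let `P i₀` have no root on the circle `‖z − z₀‖ = ρ` (`ρ > 0`).  Then for `i` near `i₀`, `P i` and `P i₀` have the same
number of roots, counted with multiplicity, in the open disc `‖z − z₀‖ < ρ` (Rouché: on the circle `|P i₀|` is bounded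
below and `P i → P i₀` uniformly). -/
theorem card_roots_ball_eventually_eq {ι : Type*} [TopologicalSpace ι] {P : ι → ℂ[X]} {n : ℕ} {i₀ : ι}
    (hdeg : ∀ i, (P i).natDegree ≤ n) (hcont : ∀ k, ContinuousAt (fun i => (P i).coeff k) i₀)
    (z₀ : ℂ) {ρ : ℝ} (hρ : 0 < ρ) (hne : ∀ z, ‖z - z₀‖ = ρ → (P i₀).eval z ≠ 0) :
    ∀ᶠ i in 𝓝 i₀, ((P i).roots.filter fun z => ‖z - z₀‖ < ρ).card =
      ((P i₀).roots.filter fun z => ‖z - z₀‖ < ρ).card := by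
  have hcpt : IsCompact (Metric.sphere z₀ ρ) := isCompact_sphere z₀ ρ
  have hsne : (Metric.sphere z₀ ρ).Nonempty := NormedSpace.sphere_nonempty.2 hρ.le
  have hfc : ContinuousOn (fun z => ‖(P i₀).eval z‖) (Metric.sphere z₀ ρ) :=
    (P i₀).continuous.norm.continuousOn
  obtain ⟨w, hw, hmin⟩ := hcpt.exists_isMinOn hsne hfc
  have hw' : ‖w - z₀‖ = ρ := by simpa [Metric.mem_sphere, dist_eq_norm] using hw
  set δ := ‖(P i₀).eval w‖ with hδ
  have hδpos : 0 < δ := norm_pos_iff.2 (hne w hw')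
  set R := ‖z₀‖ + ρ with hR
  have htend : Tendsto (fun i => ∑ k ∈ Finset.range (n + 1), ‖(P i).coeff k - (P i₀).coeff k‖ * R ^ k)
      (𝓝 i₀) (𝓝 0) := by
    have h0 : (∑ k ∈ Finset.range (n + 1), ‖(P i₀).coeff k - (P i₀).coeff k‖ * R ^ k) = 0 := by simp
    rw [← h0]
    refine tendsto_finsetSum _ fun k _ => ?_
    exact (((hcont k).tendsto.sub tendsto_const_nhds).norm).mul_const _
  have hev : ∀ᶠ i in 𝓝 i₀, ∑ k ∈ Finset.range (n + 1), ‖(P i).coeff k - (P i₀).coeff k‖ * R ^ k < δ :=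
    (tendsto_order.1 htend).2 δ hδpos
  filter_upwards [hev] with i hi
  refine card_roots_eq_of_norm_sub_lt z₀ hρ fun z hz => ?_
  have hzR : ‖z‖ ≤ R := by
    calc ‖z‖ = ‖(z - z₀) + z₀‖ := by rw [sub_add_cancel]
      _ ≤ ‖z - z₀‖ + ‖z₀‖ := norm_add_le _ _
      _ = R := by rw [hz, hR, add_comm]
  calc ‖(P i).eval z - (P i₀).eval z‖ = ‖(P i - P i₀).eval z‖ := by rw [eval_sub]
    _ ≤ ∑ k ∈ Finset.range (n + 1), ‖(P i - P i₀).coeff k‖ * R ^ k :=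
        norm_eval_le_sum ((natDegree_sub_le _ _).trans (max_le (hdeg i) (hdeg i₀))) hzR
    _ = ∑ k ∈ Finset.range (n + 1), ‖(P i).coeff k - (P i₀).coeff k‖ * R ^ k := by
        simp only [coeff_sub]
    _ < δ := hi
    _ ≤ ‖(P i₀).eval z‖ := hmin (show z ∈ Metric.sphere z₀ ρ by
        simpa [Metric.mem_sphere, dist_eq_norm] using hz)

/-- Over `ℂ` the number of roots with multiplicity is the degree, so a polynomial of degree `≤ n` with non-zero
`n`-th coefficient has exactly `n` roots. -/
theorem card_roots_eq_of_coeff_ne_zero {p : ℂ[X]} {n : ℕ} (hdeg : p.natDegree ≤ n) (hn : p.coeff n ≠ 0) :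
    p.roots.card = n := by
  rw [IsAlgClosed.card_roots_eq_natDegree]
  exact le_antisymm hdeg (le_natDegree_of_ne_zero hn)

/-- **Bookkeeping lemma (persistence of root counts with local side information).**  Let `P i ∈ ℂ[X]` have degree
`≤ n`, coefficients continuous at `i₀`, and `(P i₀).coeff n ≠ 0`.  Suppose every root `z` of `P i₀` has a radius
`ρ > 0` such that, eventually along a filter `l ≤ 𝓝 i₀`, every root `w` of `P i` with `‖w − z‖ < ρ` satisfies
`w ∈ V ↔ τ z`.  Then eventually along `l` the number of roots of `P i` in `V` (with multiplicity) equals the number of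
roots `z` of `P i₀` (with multiplicity) with `τ z`.  (Small disjoint discs around the roots of `P i₀` keep their root
counts by `card_roots_ball_eventually_eq`; they capture all `n` roots of `P i`; then add up.) -/
theorem card_roots_filter_eventually_eq {ι : Type*} [TopologicalSpace ι] {P : ι → ℂ[X]} {n : ℕ} {i₀ : ι}
    {l : Filter ι} (hl : l ≤ 𝓝 i₀) (hdeg : ∀ i, (P i).natDegree ≤ n) (hlead : (P i₀).coeff n ≠ 0)
    (hcont : ∀ k, ContinuousAt (fun i => (P i).coeff k) i₀) (V : Set ℂ) [DecidablePred (· ∈ V)]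
    (τ : ℂ → Prop) [DecidablePred τ]
    (hside : ∀ z ∈ (P i₀).roots, ∃ ρ : ℝ, 0 < ρ ∧
      ∀ᶠ i in l, ∀ w ∈ (P i).roots, ‖w - z‖ < ρ → (w ∈ V ↔ τ z)) :
    ∀ᶠ i in l, ((P i).roots.filter (· ∈ V)).card = ((P i₀).roots.filter τ).card := by
  classical
  set R₀ := (P i₀).roots with hR₀
  set S := R₀.toFinset with hS
  -- radii from the side information, made uniform over the finite set of roots
  have hside' : ∀ z ∈ S, ∃ ρ : ℝ, 0 < ρ ∧
      ∀ᶠ i in l, ∀ w ∈ (P i).roots, ‖w - z‖ < ρ → (w ∈ V ↔ τ z) :=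
    fun z hz => hside z (Multiset.mem_toFinset.1 hz)
  choose! ρf hρf hevf using hside'
  obtain ⟨ρ₁, hρ₁, hρ₁le⟩ := exists_pos_forall_le S ρf hρf
  obtain ⟨ρ₂, hρ₂, hρ₂le⟩ := exists_pos_forall_le S.offDiag (fun zz => ‖zz.1 - zz.2‖ / 3)
    (fun zz hzz => by
      have h := (Finset.mem_offDiag.1 hzz).2.2
      have : 0 < ‖zz.1 - zz.2‖ := norm_pos_iff.2 (sub_ne_zero.2 h)
      positivity)
  set ρ := min ρ₁ ρ₂ with hρdef
  have hρ : 0 < ρ := lt_min hρ₁ hρ₂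
  have hρS : ∀ z ∈ S, ρ ≤ ρf z := fun z hz => (min_le_left _ _).trans (hρ₁le z hz)
  have hsep : ∀ z ∈ S, ∀ z' ∈ S, z ≠ z' → 3 * ρ ≤ ‖z - z'‖ := by
    intro z hz z' hz' hne
    have h := hρ₂le (z, z') (Finset.mem_offDiag.2 ⟨hz, hz', hne⟩)
    have : ρ ≤ ‖z - z'‖ / 3 := (min_le_right _ _).trans h
    linarith
  -- no root of `P i₀` on the circles of radius ρ
  have hcirc : ∀ z ∈ S, ∀ w, ‖w - z‖ = ρ → (P i₀).eval w ≠ 0 := by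
    intro z hz w hw h0
    have hP0 : P i₀ ≠ 0 := fun h => hlead (by rw [h, coeff_zero])
    have hwS : w ∈ S := Multiset.mem_toFinset.2 ((mem_roots hP0).2 h0)
    by_cases hwz : w = z
    · rw [hwz, sub_self, norm_zero] at hw
      exact hρ.ne' hw.symm
    · have := hsep w hwS z hz hwz
      linarith
  -- disc counts persist, for all roots simultaneously
  have hdisc : ∀ᶠ i in 𝓝 i₀, ∀ z ∈ S, ((P i).roots.filter fun w => ‖w - z‖ < ρ).card =
      (R₀.filter fun w => ‖w - z‖ < ρ).card :=
    (S.eventually_all).2 fun z hz => card_roots_ball_eventually_eq hdeg hcont z hρ (hcirc z hz)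
  -- the top coefficient stays non-zero
  have htop : ∀ᶠ i in 𝓝 i₀, (P i).coeff n ≠ 0 := (hcont n).eventually_ne hlead
  have hsideS : ∀ᶠ i in l, ∀ z ∈ S, ∀ w ∈ (P i).roots, ‖w - z‖ < ρf z → (w ∈ V ↔ τ z) :=
    (S.eventually_all).2 fun z hz => hevf z hz
  filter_upwards [hl hdisc, hl htop, hsideS] with i hdi hti hsi
  set R := (P i).roots with hR
  -- in the disc around z ∈ S the only root of P i₀ is z, with its multiplicity
  have hcount : ∀ z ∈ S, (R₀.filter fun w => ‖w - z‖ < ρ) = Multiset.replicate (R₀.count z) z := by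
    intro z hz
    rw [← Multiset.filter_eq' R₀ z]
    refine Multiset.filter_congr fun w hw => ?_
    constructor
    · intro hwlt
      by_contra hwz
      have := hsep w (Multiset.mem_toFinset.2 hw) z hz hwz
      linarith
    · intro hwz
      rw [hwz, sub_self, norm_zero]
      exact hρ
  -- pairwise disjointness of the discs on R
  have hdisjR : ∀ z ∈ S, ∀ z' ∈ S, z ≠ z' → ∀ w ∈ R, ‖w - z‖ < ρ → ¬ ‖w - z'‖ < ρ := by
    intro z hz z' hz' hne w _ h1 h2
    have h3 := hsep z hz z' hz' hne
    have : ‖z - z'‖ ≤ ‖w - z‖ + ‖w - z'‖ := by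
      calc ‖z - z'‖ = ‖(w - z') - (w - z)‖ := by rw [show (w - z') - (w - z) = z - z' by ring]
        _ ≤ ‖w - z'‖ + ‖w - z‖ := norm_sub_le _ _
        _ = ‖w - z‖ + ‖w - z'‖ := add_comm _ _
    linarith
  -- all roots of P i are captured by the discs
  have hcardR : R.card = n := card_roots_eq_of_coeff_ne_zero (hdeg i) hti
  have hcardR₀ : R₀.card = n := card_roots_eq_of_coeff_ne_zero (hdeg i₀) hlead
  have hsum : (R.filter fun w => ∃ z ∈ S, ‖w - z‖ < ρ).card = n := by
    have hsplit := filter_exists_eq_sum R S (fun z w => ‖w - z‖ < ρ) hdisjR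
    beta_reduce at hsplit
    rw [hsplit, Multiset.card_sum]
    calc ∑ z ∈ S, (R.filter fun w => ‖w - z‖ < ρ).card
        = ∑ z ∈ S, (R₀.filter fun w => ‖w - z‖ < ρ).card := Finset.sum_congr rfl fun z hz => hdi z hz
      _ = ∑ z ∈ S, R₀.count z := Finset.sum_congr rfl fun z hz => by
          rw [hcount z hz, Multiset.card_replicate]
      _ = R₀.card := Multiset.toFinset_sum_count_eq R₀
      _ = n := hcardR₀
  have hall : ∀ w ∈ R, ∃ z ∈ S, ‖w - z‖ < ρ := by
    have hle : (R.filter fun w => ∃ z ∈ S, ‖w - z‖ < ρ) ≤ R := Multiset.filter_le _ _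
    have heq := Multiset.eq_of_le_of_card_le hle (by rw [hsum, hcardR])
    intro w hw
    rw [← heq] at hw
    exact (Multiset.mem_filter.1 hw).2
  -- count the roots of P i in V disc by disc
  have hV : (R.filter (· ∈ V)) = R.filter fun w => ∃ z ∈ S, (‖w - z‖ < ρ ∧ τ z) := by
    refine Multiset.filter_congr fun w hw => ?_
    constructor
    · intro hwV
      obtain ⟨z, hz, hwz⟩ := hall w hw
      exact ⟨z, hz, hwz, (hsi z hz w hw (hwz.trans_le (hρS z hz))).1 hwV⟩
    · rintro ⟨z, hz, hwz, hτ⟩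
      exact (hsi z hz w hw (hwz.trans_le (hρS z hz))).2 hτ
  have hdisjR' : ∀ z ∈ S, ∀ z' ∈ S, z ≠ z' → ∀ w ∈ R,
      (‖w - z‖ < ρ ∧ τ z) → ¬ (‖w - z'‖ < ρ ∧ τ z') :=
    fun z hz z' hz' hne w hw h1 h2 => hdisjR z hz z' hz' hne w hw h1.1 h2.1
  have hsplit' := filter_exists_eq_sum R S (fun z w => ‖w - z‖ < ρ ∧ τ z) hdisjR'
  beta_reduce at hsplit'
  rw [hV, hsplit', Multiset.card_sum]
  -- the right-hand side, root by root
  have hrhs : (R₀.filter τ).card = ∑ z ∈ S, if τ z then R₀.count z else 0 := by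
    rw [← Multiset.toFinset_sum_count_eq (R₀.filter τ)]
    have hsubS : (R₀.filter τ).toFinset ⊆ S :=
      Multiset.toFinset_subset.2 (Multiset.filter_subset _ _)
    rw [Finset.sum_subset hsubS (fun z _ hz =>
      Multiset.count_eq_zero.2 fun h => hz (Multiset.mem_toFinset.2 h))]
    exact Finset.sum_congr rfl fun z _ => Multiset.count_filter
  rw [hrhs]
  refine Finset.sum_congr rfl fun z hz => ?_
  by_cases hτ : τ z
  · rw [if_pos hτ]
    have : (R.filter fun w => ‖w - z‖ < ρ ∧ τ z) = R.filter fun w => ‖w - z‖ < ρ :=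
      Multiset.filter_congr fun w _ => by simp [hτ]
    rw [this, hdi z hz, hcount z hz, Multiset.card_replicate]
  · rw [if_neg hτ]
    have : (R.filter fun w => ‖w - z‖ < ρ ∧ τ z) = 0 :=
      Multiset.filter_eq_nil.2 fun w _ h => hτ h.2
    rw [this, Multiset.card_zero]

/-- Side information from an open set: if a root `z` lies in an open set `O` on which membership in `V` is decided as it
is for `z`, then `O` contains a disc around `z` witnessing the hypothesis of `card_roots_filter_eventually_eq` (for every
family and every filter). -/
theorem side_of_isOpen {ι : Type*} {l : Filter ι} (P : ι → ℂ[X]) {O V : Set ℂ} (hO : IsOpen O) {z : ℂ}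
    (hz : z ∈ O) (hOV : ∀ w ∈ O, (w ∈ V ↔ z ∈ V)) :
    ∃ ρ : ℝ, 0 < ρ ∧ ∀ᶠ i in l, ∀ w ∈ (P i).roots, ‖w - z‖ < ρ → (w ∈ V ↔ z ∈ V) := by
  obtain ⟨ρ, hρ, hball⟩ := Metric.isOpen_iff.1 hO z hz
  refine ⟨ρ, hρ, Eventually.of_forall fun i w _ hw => hOV w (hball ?_)⟩
  simpa [Metric.mem_ball, dist_eq_norm] using hw

/-- **Local constancy of the root count in an open set off whose boundary the roots stay.**  With `U`, `E` open and
disjoint: if all roots of `P i₀` lie in `U ∪ E`, then for `i` near `i₀` the number of roots of `P i` in `U` equals that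
of `P i₀`. -/
theorem card_roots_filter_mem_eventually_eq {ι : Type*} [TopologicalSpace ι] {P : ι → ℂ[X]} {n : ℕ} {i₀ : ι}
    (hdeg : ∀ i, (P i).natDegree ≤ n) (hlead : (P i₀).coeff n ≠ 0)
    (hcont : ∀ k, ContinuousAt (fun i => (P i).coeff k) i₀) {U E : Set ℂ} (hU : IsOpen U) (hE : IsOpen E)
    (hUE : Disjoint U E) [DecidablePred (· ∈ U)] (hroots : ∀ z ∈ (P i₀).roots, z ∈ U ∪ E) :
    ∀ᶠ i in 𝓝 i₀, ((P i).roots.filter (· ∈ U)).card = ((P i₀).roots.filter (· ∈ U)).card := by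
  refine card_roots_filter_eventually_eq le_rfl hdeg hlead hcont U (· ∈ U) fun z hz => ?_
  rcases hroots z hz with hzU | hzE
  · exact side_of_isOpen P hU hzU fun w hw => by simp [hw, hzU]
  · refine side_of_isOpen P hE hzE fun w hw => ?_
    have hwU : w ∉ U := fun h => hUE.le_bot ⟨h, hw⟩
    have hzU : z ∉ U := fun h => hUE.le_bot ⟨h, hzE⟩
    simp [hwU, hzU]

/-- **Constancy of the root count along a preconnected parameter set (side-information form).**  If along a
preconnected set `J` the top coefficient never vanishes and at every parameter every root carries local side
information for the set `V` (as in `card_roots_filter_eventually_eq`, with `τ = (· ∈ V)`), then the number of roots in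
`V`, counted with multiplicity, is the same for all parameters in `J`. -/
theorem card_roots_filter_eq_of_preconnected' {ι : Type*} [TopologicalSpace ι] {P : ι → ℂ[X]} {n : ℕ}
    (hdeg : ∀ i, (P i).natDegree ≤ n) (hcont : ∀ k, Continuous fun i => (P i).coeff k)
    {J : Set ι} (hJ : IsPreconnected J) (hlead : ∀ i ∈ J, (P i).coeff n ≠ 0)
    (V : Set ℂ) [DecidablePred (· ∈ V)]
    (hside : ∀ i ∈ J, ∀ z ∈ (P i).roots, ∃ ρ : ℝ, 0 < ρ ∧
      ∀ᶠ j in 𝓝 i, ∀ w ∈ (P j).roots, ‖w - z‖ < ρ → (w ∈ V ↔ z ∈ V))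
    {i j : ι} (hi : i ∈ J) (hj : j ∈ J) :
    ((P i).roots.filter (· ∈ V)).card = ((P j).roots.filter (· ∈ V)).card := by
  refine hJ.constant (f := fun i => ((P i).roots.filter (· ∈ V)).card) (fun i₀ hi₀ => ?_) hi hj
  have hev := card_roots_filter_eventually_eq (l := 𝓝 i₀) le_rfl hdeg (hlead i₀ hi₀)
    (fun k => (hcont k).continuousAt) V (· ∈ V) (hside i₀ hi₀)
  have hca : ContinuousAt (fun i => ((P i).roots.filter (· ∈ V)).card) i₀ :=
    tendsto_const_nhds.congr' (hev.mono fun i h => h.symm)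
  exact hca.continuousWithinAt

/-- **Constancy of the root count along a preconnected parameter set.**  If along a preconnected set `J` of
parameters the top coefficient never vanishes and every root stays in `U ∪ E` (`U`, `E` open, disjoint), then the
number of roots in `U`, counted with multiplicity, is the same for all parameters in `J`. -/
theorem card_roots_filter_eq_of_preconnected {ι : Type*} [TopologicalSpace ι] {P : ι → ℂ[X]} {n : ℕ}
    (hdeg : ∀ i, (P i).natDegree ≤ n) (hcont : ∀ k, Continuous fun i => (P i).coeff k)
    {J : Set ι} (hJ : IsPreconnected J) (hlead : ∀ i ∈ J, (P i).coeff n ≠ 0)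
    {U E : Set ℂ} (hU : IsOpen U) (hE : IsOpen E) (hUE : Disjoint U E) [DecidablePred (· ∈ U)]
    (hroots : ∀ i ∈ J, ∀ z ∈ (P i).roots, z ∈ U ∪ E) {i j : ι} (hi : i ∈ J) (hj : j ∈ J) :
    ((P i).roots.filter (· ∈ U)).card = ((P j).roots.filter (· ∈ U)).card := by
  refine card_roots_filter_eq_of_preconnected' hdeg hcont hJ hlead U (fun i₀ hi₀ z hz => ?_) hi hj
  rcases hroots i₀ hi₀ z hz with hzU | hzE
  · exact side_of_isOpen P hU hzU fun w hw => by simp [hw, hzU]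
  · refine side_of_isOpen P hE hzE fun w hw => ?_
    have hwU : w ∉ U := fun h => hUE.le_bot ⟨h, hw⟩
    have hzU : z ∉ U := fun h => hUE.le_bot ⟨h, hzE⟩
    simp [hwU, hzU]

end TieLaw

end Summit.ValiantsHypothesis.ValiantsHypothesis.Theorems.LacunarySymmetroidMatrixDescartes
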